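/-
Copyright: the b2b-balaban T⁴-continuum CRUX team, row NE7b leaf lineage `t4-ne7b-formalise-leaf-01` (gen 87). Project licence.
-/
import Literature.MathematicalPhysics.QuantumFieldTheory.Balaban1983to89.B5Hk103ScalarZd

/-!
# THE ONE-SHOT SECTION IS COVARIANT UNDER PERMUTATIONS OF THE AXES: `H(p ∘ π, y ∘ π) = H(p, y)` for every `π ∈ Sym(Fin d)`, every side, every `d`
# (row NE7b, node U5c; the companion of leaf-06 g159's `OneShotChartReflection` (one-axis flips): together they give the full hyperoctahedral
# `B_d = (ℤ∕2)^d ⋊ S_d` invariance of `G′`, `Q′G′Q′*`, `(Q′G′Q′*)⁻¹` and `kerH` on `ℤ^d`; [folklore] symmetry bookkeeping, uniqueness pattern (54) ∕ OSCRF)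

Cell `pub-balaban`, sub-cell `t4`, spine estimate NE7b (`T4WeightBudget.RelWeightBound`; the cell's OWN estimate — NOT PRINTED in [Bałaban 1983–89], NOT
PROVED).  Crux-route work under `Spine/NE7b/` by a row leaf (`t4-ne7b-formalise-leaf-01` gen 87) under FREEZE (0)'s crux-prover clause; NOTHING of Bałaban's
is named as a Lean object, valued or asserted; no `T4Continuum/Support` leaf typed; no `def` (the axis permutation acts by precomposition `p ↦ p ∘ π`, written
inline); zero `sorry`.  Import: the Literature module `B5Hk103ScalarZd` ONLY (`Gk`, `gq`, `Kinv`, `kerH`, the uniqueness `B4Sect5Exhaustion.eq_limInv_of_left_inverse`).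

WHY.  The side-2 certificate files of this lineage (BSRV ∕ BSRK) store CERT-1's competitor by ORBITS of the hyperoctahedral group — 495 values for `9⁴·16`
sites — and OSCRF typed the flips; the axis permutations were the missing half of the symmetry AT THE LEVEL OF `kerH` ITSELF.  With both, every statement
about a row `y ↦ H(p, y)` can be moved to a canonical representative of `(p, y)` (sorted reflection classes), which is what shrinks certificate data and torus
tables (leaf-03's TCS2 ∕ TCS3 sectors) and what lets a consumer quote ONE row for all sixteen residue classes and all `4!` axis orders.

WHAT IS PROVED (every `d`, every side `n + 1`, every `a > 0`, every `π : Equiv.Perm (Fin d)`; [folklore]):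
* §1 lattice: `comp_perm_injective`, `blk_comp_perm` (`blk n (p ∘ π) = blk n p ∘ π`), `mem_B_comp_perm_iff`, `sum_B_comp_perm`
  (`Σ_{q ∈ B(y∘π)} f q = Σ_{q ∈ B y} f (q ∘ π)`), `comp_perm_add_e` ∕ `comp_perm_sub_e` (`(p ± e_μ) ∘ π = p ∘ π ± e_{π⁻¹ μ}`), `lapDir_comp_perm`
  (`lapDir ν (p∘π) (q∘π) = lapDir (π ν) p q`), `lapKer_comp_perm`, `sameBlk_comp_perm`, **`AX_comp_perm`** (the site matrix `Δ^η + aQ′*Q′` is permutation-invariant).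
* §2 covariance by uniqueness: **`Gk_comp_perm`**, `gq_comp_perm`, `kerQGQ_comp_perm`, **`Kinv_comp_perm`**, **`kerH_comp_perm`** (`kerH n a (p ∘ π) (y ∘ π) = kerH n a p y`).

HONEST: [folklore] symmetry bookkeeping; no number enters; scalar `U = 1` block-mean skeleton on `ℤ^d`; nothing of (A3) ∕ NC-NE7b-α; BY-NAME EFFECT ON THE WALL:
NONE.  NE7b NOT PRINTED ∕ NOT PROVED; spine PROVED 0∕9; rung (B)+1 on a FINITE torus — NOT infinite volume, NOT the mass gap, NOT Clay.  HONEST DEPENDENCY: continuum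
YM on T⁴ ⇐ BetaPertH ∧ nine spine estimates (0∕9 proved); BetaPertH ⇐ (D1) ∧ (D4) ∧ CAP+tail; G-an2-4 gates asym, D1 and NE2∕3∕4.
-/

set_option autoImplicit false

namespace Summit.QuantumFields.BalabanUV.T4Continuum.NE7b.OneShotChartAxisPermutation

open Finset
open Literature.MathematicalPhysics.QuantumFieldTheory.Balaban1983to89
open B4Sect5Exhaustion (limInv eq_limInv_of_left_inverse)
open B6QGQLower276 (X B e blk loc side chart mem_B lapDir lapKer sameBlk AX Aker kerQGQ KerQGQ gammaQ gammaQ_pos c0 c0_pos hyp56Z_Aker)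
open B6QGQDecay237 (cU cU_pos deltaU deltaU_pos cInv cInv_pos deltaInv deltaInv_pos hyp56Z_KerQGQ_unif)
open B5Hk103ScalarZd (Gk gq Kinv kerH toK abs_Gk_le abs_Kinv_le tsum_Gk_mul_AX tsum_Kinv_mul_kerQGQ)

variable {d : ℕ} (n : ℕ) (π : Equiv.Perm (Fin d))

/-! ## §1. An axis permutation of the two-scale lattice -/

/-- Precomposition with `π` is injective on `ℤ^d`. [folklore] -/
theorem comp_perm_injective : Function.Injective (fun p : X d => p ∘ π) := by
  intro p q h
  funext ν
  have := congr_fun h (π.symm ν)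
  simpa using this

/-- Precomposition with `π` undone by `π⁻¹`: `(p ∘ π) ∘ π⁻¹ = p`. [folklore] -/
theorem comp_perm_comp_symm (p : X d) : (p ∘ π) ∘ π.symm = p := by
  funext ν; simp

/-- `(p ∘ π⁻¹) ∘ π = p`. [folklore] -/
theorem comp_symm_comp_perm (p : X d) : (p ∘ π.symm) ∘ π = p := by
  funext ν; simp

/-- **`π` MAPS BLOCKS TO BLOCKS**: `blk n (p ∘ π) = blk n p ∘ π` (the block map is coordinatewise). [folklore] -/
theorem blk_comp_perm (p : X d) : blk n (p ∘ π) = blk n p ∘ π := by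
  funext ν; rfl

/-- membership transport: `q ∈ B n (y ∘ π) ↔ q ∘ π⁻¹ ∈ B n y`. [folklore] -/
theorem mem_B_comp_perm_iff (y q : X d) : q ∈ B n (y ∘ π) ↔ q ∘ π.symm ∈ B n y := by
  rw [mem_B, mem_B, blk_comp_perm]
  constructor
  · intro h; rw [h]; exact comp_perm_comp_symm π y
  · intro h
    have := congrArg (fun f : X d => f ∘ π) h
    simpa [comp_symm_comp_perm] using this

/-- **BLOCK SUMS TRANSPORT**: `Σ_{q ∈ B n (y ∘ π)} f q = Σ_{q ∈ B n y} f (q ∘ π)`. [folklore] -/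
theorem sum_B_comp_perm (y : X d) (f : X d → ℝ) : ∑ q ∈ B n (y ∘ π), f q = ∑ q ∈ B n y, f (q ∘ π) := by
  symm
  refine Finset.sum_nbij' (fun q => q ∘ π) (fun q => q ∘ π.symm) (fun q hq => ?_) (fun q hq => ?_) (fun q _ => comp_perm_comp_symm π q)
    (fun q _ => comp_symm_comp_perm π q) (fun q _ => rfl)
  · rw [mem_B] at hq ⊢
    rw [blk_comp_perm, hq]
  · exact (mem_B_comp_perm_iff n π y q).1 hq

/-- neighbours: `(p + e_μ) ∘ π = p ∘ π + e_{π⁻¹ μ}`. [folklore] -/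
theorem comp_perm_add_e (p : X d) (μ : Fin d) : (p + e μ) ∘ π = p ∘ π + e (π.symm μ) := by
  funext κ
  simp only [Function.comp_apply, Pi.add_apply, e, Pi.single_apply]
  by_cases h : π κ = μ
  · rw [if_pos h, if_pos ((Equiv.eq_symm_apply π).2 h)]
  · rw [if_neg h, if_neg (fun hk => h ((Equiv.eq_symm_apply π).1 hk))]

/-- neighbours: `(p − e_μ) ∘ π = p ∘ π − e_{π⁻¹ μ}`. [folklore] -/
theorem comp_perm_sub_e (p : X d) (μ : Fin d) : (p - e μ) ∘ π = p ∘ π - e (π.symm μ) := by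
  funext κ
  simp only [Function.comp_apply, Pi.sub_apply, e, Pi.single_apply]
  by_cases h : π κ = μ
  · rw [if_pos h, if_pos ((Equiv.eq_symm_apply π).2 h)]
  · rw [if_neg h, if_neg (fun hk => h ((Equiv.eq_symm_apply π).1 hk))]

/-- the directional second difference along `ν` after the permutation is the one along `π ν` before it. [folklore] -/
theorem lapDir_comp_perm (ν : Fin d) (p q : X d) : lapDir ν (p ∘ π) (q ∘ π) = lapDir (π ν) p q := by
  have hinj := comp_perm_injective π
  unfold lapDir
  have h1 : (q ∘ π = p ∘ π) ↔ (q = p) := hinj.eq_iff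
  have h2 : (q ∘ π = p ∘ π + e ν) ↔ (q = p + e (π ν)) := by
    have : p ∘ π + e ν = (p + e (π ν)) ∘ π := by rw [comp_perm_add_e, Equiv.symm_apply_apply]
    rw [this]; exact hinj.eq_iff
  have h3 : (q ∘ π = p ∘ π - e ν) ↔ (q = p - e (π ν)) := by
    have : p ∘ π - e ν = (p - e (π ν)) ∘ π := by rw [comp_perm_sub_e, Equiv.symm_apply_apply]
    rw [this]; exact hinj.eq_iff
  simp only [h1, h2, h3]

/-- the lattice Laplacian kernel is permutation-invariant (the sum over the axes is reindexed by `π`). [folklore] -/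
theorem lapKer_comp_perm (p q : X d) : lapKer (p ∘ π) (q ∘ π) = lapKer p q := by
  unfold lapKer
  simp only [lapDir_comp_perm]
  exact Equiv.sum_comp π (fun ν => lapDir ν p q)

/-- «same block» is permutation-invariant. [folklore] -/
theorem sameBlk_comp_perm (p q : X d) : sameBlk n (p ∘ π) (q ∘ π) = sameBlk n p q := by
  unfold sameBlk
  simp only [blk_comp_perm, (comp_perm_injective π).eq_iff]

/-- **THE SITE MATRIX `Δ^η + aQ′*Q′` IS PERMUTATION-INVARIANT**: `AX n a (p ∘ π) (q ∘ π) = AX n a p q`. [folklore] -/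
theorem AX_comp_perm (a : ℝ) (p q : X d) : AX n a (p ∘ π) (q ∘ π) = AX n a p q := by
  unfold AX; rw [lapKer_comp_perm, sameBlk_comp_perm]

/-- Precomposition with `π` as a bijection of `ℤ^d` (`Equiv.arrowCongr`): its action is `p ↦ p ∘ π`. [folklore] -/
theorem arrowCongr_symm_apply (p : X d) : (Equiv.arrowCongr π.symm (Equiv.refl ℤ)) p = p ∘ π := by
  funext κ; simp [Equiv.arrowCongr_apply]

/-! ## §2. Covariance of `G′`, `Q′G′Q′*`, its inverse, and the section `H` -/

/-- **`G′` IS PERMUTATION-COVARIANT**: `G′(p∘π, q∘π) = G′(p, q)` — the permuted kernel is a bounded left inverse of the permutation-invariant site matrix on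
`ℤ^d`, hence equals `limInv` (`eq_limInv_of_left_inverse`; OSCRF's `Gk_sigma` with the flip replaced by `π`). [folklore] -/
theorem Gk_comp_perm {a : ℝ} (ha : 0 < a) (p q : X d) : Gk n a (p ∘ π) (q ∘ π) = Gk n a p q := by
  have hγ : (0 : ℝ) < min 2 a := lt_min two_pos ha
  have hbd : ∀ p' q' : B4Sect5Exhaustion.K d 1, |Gk n a (p'.1 ∘ π) (q'.1 ∘ π)| ≤ 2 / min 2 a := fun p' q' => by
    refine (abs_Gk_le n ha _ _).trans (mul_le_of_le_one_right (by positivity) ?_)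
    rw [Real.exp_le_one_iff, neg_nonpos]
    have := deltaU_pos d ha
    positivity
  have hinv : ∀ p' r' : B4Sect5Exhaustion.K d 1, p'.1 ∈ (Set.univ : Set (X d)) → r'.1 ∈ (Set.univ : Set (X d)) →
      ∑' q' : B4Sect5Exhaustion.K d 1, Gk n a (p'.1 ∘ π) (q'.1 ∘ π) * Aker n a q' r' = if p' = r' then 1 else 0 := by
    intro p' r' _ _
    have h1 : ∑' q' : B4Sect5Exhaustion.K d 1, Gk n a (p'.1 ∘ π) (q'.1 ∘ π) * Aker n a q' r'
        = ∑' w : X d, Gk n a (p'.1 ∘ π) (w ∘ π) * AX n a w r'.1 := by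
      rw [← Equiv.tsum_eq (toK (d := d))]
      rfl
    have h2 : ∀ w : X d, Gk n a (p'.1 ∘ π) (w ∘ π) * AX n a w r'.1 = Gk n a (p'.1 ∘ π) (w ∘ π) * AX n a (w ∘ π) (r'.1 ∘ π) := fun w => by
      rw [AX_comp_perm n π]
    have h3 : ∑' w : X d, Gk n a (p'.1 ∘ π) (w ∘ π) * AX n a (w ∘ π) (r'.1 ∘ π)
        = ∑' w' : X d, Gk n a (p'.1 ∘ π) w' * AX n a w' (r'.1 ∘ π) := by
      rw [← (Equiv.arrowCongr π.symm (Equiv.refl ℤ)).tsum_eq (fun w' => Gk n a (p'.1 ∘ π) w' * AX n a w' (r'.1 ∘ π))]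
      simp only [arrowCongr_symm_apply]
    rw [h1, tsum_congr h2, h3, tsum_Gk_mul_AX n ha]
    have hiff : p'.1 ∘ π = r'.1 ∘ π ↔ p' = r' := by
      rw [(comp_perm_injective π).eq_iff]
      exact ⟨fun h => Prod.ext h (Subsingleton.elim _ _), fun h => by rw [h]⟩
    simp only [hiff]
  exact eq_limInv_of_left_inverse hγ (c0_pos d n ha.ne') one_pos (hyp56Z_Aker (d := d) n a)
    (D := fun p' q' : B4Sect5Exhaustion.K d 1 => Gk n a (p'.1 ∘ π) (q'.1 ∘ π)) (M := 2 / min 2 a) hbd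
    (fun p' q' h => absurd (Set.mem_univ _) h) hinv (p := (p, 0)) (s := (q, 0)) (Set.mem_univ _) (Set.mem_univ _)

/-- `G′Q′*` is covariant: `gq n a (p ∘ π) (y ∘ π) = gq n a p y`. [folklore] -/
theorem gq_comp_perm {a : ℝ} (ha : 0 < a) (p y : X d) : gq n a (p ∘ π) (y ∘ π) = gq n a p y := by
  unfold gq
  rw [sum_B_comp_perm n π]
  exact Finset.sum_congr rfl fun q _ => Gk_comp_perm n π ha p q

/-- `Q′G′Q′*` is covariant: `kerQGQ n a (y ∘ π) (y' ∘ π) = kerQGQ n a y y'`. [folklore] -/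
theorem kerQGQ_comp_perm {a : ℝ} (ha : 0 < a) (y y' : X d) : kerQGQ n a (y ∘ π) (y' ∘ π) = kerQGQ n a y y' := by
  unfold kerQGQ
  congr 1
  rw [sum_B_comp_perm n π]
  refine Finset.sum_congr rfl fun p _ => ?_
  rw [sum_B_comp_perm n π]
  refine Finset.sum_congr rfl fun q _ => ?_
  exact Gk_comp_perm n π ha p q

/-- **`(Q′G′Q′*)⁻¹` IS COVARIANT**: `Kinv n a (y ∘ π) (y' ∘ π) = Kinv n a y y'` (the permuted kernel is a bounded left inverse of the permutation-invariant
`Q′G′Q′*` on `ℤ^d`; `eq_limInv_of_left_inverse`). [folklore] -/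
theorem Kinv_comp_perm {a : ℝ} (ha : 0 < a) (y y' : X d) : Kinv n a (y ∘ π) (y' ∘ π) = Kinv n a y y' := by
  have hγ := gammaQ_pos d ha
  have hbd : ∀ p' q' : B4Sect5Exhaustion.K d 1, |Kinv n a (p'.1 ∘ π) (q'.1 ∘ π)| ≤ cInv d a := fun p' q' => by
    refine (abs_Kinv_le n ha _ _).trans (mul_le_of_le_one_right (cInv_pos d ha).le ?_)
    rw [Real.exp_le_one_iff, neg_nonpos]
    have := deltaInv_pos d ha
    positivity
  have hinv : ∀ p' r' : B4Sect5Exhaustion.K d 1, p'.1 ∈ (Set.univ : Set (X d)) → r'.1 ∈ (Set.univ : Set (X d)) →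
      ∑' q' : B4Sect5Exhaustion.K d 1, Kinv n a (p'.1 ∘ π) (q'.1 ∘ π) * KerQGQ n a q' r' = if p' = r' then 1 else 0 := by
    intro p' r' _ _
    have h1 : ∑' q' : B4Sect5Exhaustion.K d 1, Kinv n a (p'.1 ∘ π) (q'.1 ∘ π) * KerQGQ n a q' r'
        = ∑' w : X d, Kinv n a (p'.1 ∘ π) (w ∘ π) * kerQGQ n a w r'.1 := by
      rw [← Equiv.tsum_eq (toK (d := d))]
      rfl
    have h2 : ∀ w : X d, Kinv n a (p'.1 ∘ π) (w ∘ π) * kerQGQ n a w r'.1 = Kinv n a (p'.1 ∘ π) (w ∘ π) * kerQGQ n a (w ∘ π) (r'.1 ∘ π) :=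
      fun w => by rw [kerQGQ_comp_perm n π ha]
    have h3 : ∑' w : X d, Kinv n a (p'.1 ∘ π) (w ∘ π) * kerQGQ n a (w ∘ π) (r'.1 ∘ π)
        = ∑' w' : X d, Kinv n a (p'.1 ∘ π) w' * kerQGQ n a w' (r'.1 ∘ π) := by
      rw [← (Equiv.arrowCongr π.symm (Equiv.refl ℤ)).tsum_eq (fun w' => Kinv n a (p'.1 ∘ π) w' * kerQGQ n a w' (r'.1 ∘ π))]
      simp only [arrowCongr_symm_apply]
    rw [h1, tsum_congr h2, h3, tsum_Kinv_mul_kerQGQ n ha]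
    have hiff : p'.1 ∘ π = r'.1 ∘ π ↔ p' = r' := by
      rw [(comp_perm_injective π).eq_iff]
      exact ⟨fun h => Prod.ext h (Subsingleton.elim _ _), fun h => by rw [h]⟩
    simp only [hiff]
  exact eq_limInv_of_left_inverse hγ (cU_pos d ha) (deltaU_pos d ha) (hyp56Z_KerQGQ_unif (d := d) n ha)
    (D := fun p' q' : B4Sect5Exhaustion.K d 1 => Kinv n a (p'.1 ∘ π) (q'.1 ∘ π)) (M := cInv d a) hbd
    (fun p' q' h => absurd (Set.mem_univ _) h) hinv (p := (y, 0)) (s := (y', 0)) (Set.mem_univ _) (Set.mem_univ _)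

/-- **THE ONE-SHOT SECTION IS PERMUTATION-COVARIANT**: `kerH n a (p ∘ π) (y ∘ π) = kerH n a p y`. [folklore] -/
theorem kerH_comp_perm {a : ℝ} (ha : 0 < a) (p y : X d) : kerH n a (p ∘ π) (y ∘ π) = kerH n a p y := by
  unfold kerH
  rw [← (Equiv.arrowCongr π.symm (Equiv.refl ℤ)).tsum_eq (fun w => gq n a (p ∘ π) w * Kinv n a w (y ∘ π))]
  exact tsum_congr fun w => by
    simp only [arrowCongr_symm_apply, gq_comp_perm n π ha, Kinv_comp_perm n π ha]

/-! ## §3. Toy -/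

/-- Toy: the swap of two axes on `ℤ²` moves `(3, −1)` to `(−1, 3)`. -/
example : ((![3, -1] : X 2) ∘ (Equiv.swap (0 : Fin 2) 1)) = ![-1, 3] := by
  funext i; fin_cases i <;> simp

end Summit.QuantumFields.BalabanUV.T4Continuum.NE7b.OneShotChartAxisPermutation
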